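import Summits.RiemannHypothesis.RiemannHypothesis.Theorems.HandoffLadderRungs
import Summits.RiemannHypothesis.RiemannHypothesis.Theorems.HandoffFailingStep
import Summits.RiemannHypothesis.RiemannHypothesis.Theorems.HandoffLoadCriterion
import Summits.RiemannHypothesis.RiemannHypothesis.Theorems.HandoffMarginLaw
import Summits.RiemannHypothesis.RiemannHypothesis.Theorems.GroundBartaEvenWinsBeyondArchEndpointLog5Half
import HarnessLib

/-!
# HANDOFF — the THEOREM rungs of the H-ladder: `H(2)` and `H(3)` unconditionally, and the exact shapes of `H(5)` (cell rh-explicit, TRACK «HANDOFF», seat theory-2)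

HONEST FRAMING. Nothing here bears on the truth of RH. This file records, as kernel statements, what the tree's Weil-positivity
reach now gives for the handoff decomposition `RH ↔ Base ∧ ∀ q prime, H(q)` (`HandoffDecomposition.handoffTarget_holds`):
the GroundBarta programme's rung `EvenWinsBeyondArch.weilPositivityOn_log5half : WeilPositivityOn ((log 5)/2)` (the complete
three-prime window, unconditional, standard axioms) is EXACTLY `H(3)` (`HandoffDecomposition.handoffH_three_iff`), so the THEOREM
ladder of HANDOFF-STATEMENT §H.4/§H.16 moves from `H(2)` to `H(2), H(3)`:

* §1 `handoffH_three : H(3)`; `H(q)` and the increment `H′(q)` for every prime `q < 5`; the failed increment (if RH is false) sits at a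
  prime `q ≥ 5` (`five_le_of_not_handoffStep`, sharpening theory-1's `three_le_of_not_handoffStep`); **`RH ↔ ∀ primes q ≥ 5, H′(q)`** and
  **`RH ↔ ∀ primes q ≥ 5, H(q)`** (the exact price of «for all `q ≥ q₀`», `forall_ge_handoffStep_iff`, PAID at `q₀ = 5` by the tree rung);
  the Weil onset, if any, is `≥ (log 5)/2`.
* §2 the typed AGGREGATE objects of §H.15 at the theorem rungs, now with a THEOREM sign: wall offsets `δ*(3) ≥ 0`, `δ*(5) ≥ 0`
  (`(log 5)/2 ≤ a*({2,3})`; DATA a*({2,3}) ≈ 0.8072, single-lineage float, pre-directive), `{2,3}`-positivity at `(log 5)/2`,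
  `D_5((log 5)/2) ≤ 0`, the loads `r(2) ≤ 1`, `r(3) ≤ 1 − ε((log 5)/2)/cap(3) ≤ 1` (DATA r(3) ≈ 0.972, XCHECK §7, not certified), `N(3)`.
* §3 the NEXT rung `H(5) ↔ WeilPositivityOn ((log 7)/2)` (`nextPrime 5 = 7`) with its two certificate shapes: the two-sector shape at
  `c = (log 7)/2` itself, and the `c = 1` row of the rung table (`7 ≤ e²`): a Lean rung `WeilPositivityOn 1` (the cell's K-CELL-2 format-C
  lane, NOT in the tree at this write) or a two-sector certificate at `c = 1` would give `H(q)` for every prime `q < 7` and move the price of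
  the increment form to `q₀ = 7`.

Every statement is RH-free bookkeeping on tree theorems; no certificate is proved here and no number is certified here.

References: E. Bombieri, Rend. Mat. Acc. Lincei (9) 11 (2000) Thm. 2, §4 (`Bombieri2000Weil`); H. Yoshida, Adv. Stud. Pure Math. 21 (1992)
281–325, Thm. 1 (p. 310), Prop. 6 (p. 320) (`Yoshida1992HermitianForms`).
-/

set_option linter.dupNamespace false  -- the mandated namespace repeats `RiemannHypothesis`

noncomputable section

open Set Literature.NumberTheory.LFunctions
open Summit.RiemannHypothesis.RiemannHypothesis.Theorems
open Summit.RiemannHypothesis.RiemannHypothesis.Theorems.Handoff (ConsecutivePrimes)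
open Summit.RiemannHypothesis.RiemannHypothesis.Theorems.HandoffDecomposition
open Summit.RiemannHypothesis.RiemannHypothesis.Theorems.HandoffSemilocalEnergy
open Summit.RiemannHypothesis.RiemannHypothesis.Theorems.HandoffLoadCeiling
open Summit.RiemannHypothesis.RiemannHypothesis.Theorems.HandoffLoadCriterion
open Summit.RiemannHypothesis.RiemannHypothesis.Theorems.HandoffMarginLaw
open Summit.RiemannHypothesis.RiemannHypothesis.Theorems.HandoffLadderRungs
open Summit.RiemannHypothesis.RiemannHypothesis.Theorems.HandoffAnalytic (handoffH_of_sector_energies)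
open Summit.RiemannHypothesis.RiemannHypothesis.Theorems.EvenWinsBeyondArch (weilPositivityOn_log5half)
open Summit.RiemannHypothesis.RiemannHypothesis.Theorems.MotivicDoor.SemilocalThreshold

namespace Summit.RiemannHypothesis.RiemannHypothesis.Theorems.HandoffLadderTheoremRungs

variable {q : ℕ} {a₀ b : ℝ}

/-! ## §1  The theorem rungs `H(2)`, `H(3)` and what they pay for -/

/-- `(2, 3)` is a consecutive-prime pair. [folklore] -/
theorem consecutivePrimes_two_three : ConsecutivePrimes 2 3 := by
  have h := consecutivePrimes_nextPrime Nat.prime_two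
  rwa [nextPrime_two] at h

/-- `(3, 5)` is a consecutive-prime pair. [folklore] -/
theorem consecutivePrimes_three_five : ConsecutivePrimes 3 5 := by
  have h := consecutivePrimes_nextPrime Nat.prime_three
  rwa [nextPrime_three] at h

/-- **`H(3)` IS A THEOREM**: on the window `[(log 3)/2, (log 5)/2]` the deficit of the `{2}`-form never exceeds the contribution of `3`,
i.e. `WeilPositivityOn ((log 5)/2)` — the tree rung `EvenWinsBeyondArch.weilPositivityOn_log5half` (GroundBarta, complete three-prime
window) read through `handoffH_three_iff`. [cite: Yoshida1992HermitianForms, Prop. 6 (p. 320) (window form); tree certificate] -/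
theorem handoffH_three : HandoffH 3 := handoffH_three_iff.2 weilPositivityOn_log5half

/-- Two-argument form: `H(3, 5)`. [folklore] -/
theorem handoffH_three_five : Handoff.HandoffH 3 5 := by
  have h := handoffH_three
  unfold HandoffDecomposition.HandoffH at h
  rwa [nextPrime_three] at h

/-- `H(q)` for every prime `q < 5` (i.e. `H(2)`, `H(3)`), unconditionally. [folklore] -/
theorem forall_handoffH_of_lt_five : ∀ q : ℕ, q.Prime → q < 5 → HandoffH q := by
  intro q hq hq5
  have hle : q ≤ 3 := le_of_prime_of_lt_nextPrime hq (by rwa [nextPrime_three])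
  exact handoffH_three.anti Nat.prime_three hq hle

/-- The increment `H′(3)` holds (trivially, from `H(3)`). [folklore] -/
theorem handoffStep_three : HandoffStep 3 := fun _ ↦ handoffH_three

/-- The increments `H′(q)` hold for every prime `q < 5`. [folklore] -/
theorem forall_handoffStep_of_lt_five : ∀ q : ℕ, q.Prime → q < 5 → HandoffStep q :=
  fun q hq hq5 _ ↦ forall_handoffH_of_lt_five q hq hq5

/-- **The failed increment, if any, sits at a prime `q ≥ 5`** (theory-1's `eq_of_not_handoffStep`: at most one increment fails;
`three_le_of_not_handoffStep` sharpened by the `(log 5)/2` rung). [this track; tree rung] -/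
theorem five_le_of_not_handoffStep (hq : q.Prime) (h : ¬ HandoffStep q) : 5 ≤ q := by
  by_contra hlt
  exact h (forall_handoffStep_of_lt_five q hq (not_le.1 hlt))

/-- **`RH ↔ ∀ primes q ≥ 5, H′(q)`** — the increment form with its first two steps DISCHARGED: by theory-1's `forall_ge_handoffStep_iff`
the tail of the increments from `q₀` is worth exactly «rung at `q₀` ⟹ RH», and the rung at `q₀ = 5` is the tree theorem
`WeilPositivityOn ((log 5)/2)`. (It does not bring RH nearer: the conjunction of the remaining increments is RH.)
[cite: Bombieri2000Weil, Thm. 2; this track] -/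
theorem riemannHypothesis_iff_forall_ge_five_handoffStep :
    Summit.RiemannHypothesis ↔ ∀ q : ℕ, q.Prime → 5 ≤ q → HandoffStep q := by
  rw [forall_ge_handoffStep_iff (by norm_num : Nat.Prime 5)]
  exact ⟨fun h _ ↦ h, fun h ↦ h weilPositivityOn_log5half⟩

/-- **`RH ↔ ∀ primes q ≥ 5, H(q)`** (`H(2)`, `H(3)` are theorems). [cite: Bombieri2000Weil, Thm. 2; this track] -/
theorem riemannHypothesis_iff_forall_ge_five_handoffH :
    Summit.RiemannHypothesis ↔ ∀ q : ℕ, q.Prime → 5 ≤ q → HandoffH q := by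
  rw [riemannHypothesis_iff_forall_handoffH]
  refine ⟨fun h q hq _ ↦ h q hq, fun h q hq ↦ ?_⟩
  by_cases h5 : 5 ≤ q
  · exact h q hq h5
  · exact forall_handoffH_of_lt_five q hq (not_le.1 h5)

/-- `¬RH ↔` some prime `q ≥ 5` has `¬H(q)` (the first candidate window is `[(log 5)/2, (log 7)/2]`). [this track] -/
theorem not_riemannHypothesis_iff_exists_ge_five_not_handoffH :
    ¬ Summit.RiemannHypothesis ↔ ∃ q : ℕ, q.Prime ∧ 5 ≤ q ∧ ¬ HandoffH q := by
  rw [riemannHypothesis_iff_forall_ge_five_handoffH]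
  push Not
  rfl

/-- The Weil onset (solo-informed T56; it exists iff RH fails with a sign change of `ε`), if any, is at least `(log 5)/2`. [this track; T56] -/
theorem log_five_half_le_of_isWeilOnset (h : IsWeilOnset a₀) : Real.log 5 / 2 ≤ a₀ :=
  h.le_of_weilPositivityOn weilPositivityOn_log5half

/-! ## §2  The aggregate objects of §H.15 at the theorem rungs (RH-free quantities, now with a THEOREM sign) -/

/-- **`δ*(3) ≥ 0`**: the wall of the `{2}`-form is at or beyond `(log 3)/2` (from `H(2)`). [cite: Yoshida1992HermitianForms, Prop. 6 (p. 320)] -/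
theorem wallOffset_three_nonneg : 0 ≤ wallOffset 3 := by
  have h := (handoffH_iff_wallOffset_nonneg Nat.prime_two).1 handoffH_two
  rwa [nextPrime_two] at h

/-- **`δ*(5) ≥ 0`: the wall of the `{2,3}`-form is at or beyond `(log 5)/2`** (from `H(3)`; DATA, single-lineage float, pre-directive:
a*({2,3}) ≈ 0.8072, so δ*(5) ≈ 2.5·10⁻³ — not certified here). [cite: Yoshida1992HermitianForms, Prop. 6 (p. 320); tree rung] -/
theorem wallOffset_five_nonneg : 0 ≤ wallOffset 5 := by
  have h := (handoffH_iff_wallOffset_nonneg Nat.prime_three).1 handoffH_three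
  rwa [nextPrime_three] at h

/-- Threshold form: **`(log 5)/2 ≤ a*({p < 5})`** (`a* = weilSemilocalThreshold`, an honest maximum). [cite: Yoshida1992HermitianForms, Prop. 6 (p. 320)] -/
theorem log_five_half_le_weilSemilocalThreshold :
    Real.log 5 / 2 ≤ weilSemilocalThreshold (Nat.primesBelow 5) := by
  have h := (handoffH_iff_wallOffset Nat.prime_three).1 handoffH_three
  rwa [nextPrime_three] at h

/-- `{p < 5} = {2, 3}`. [folklore] -/
theorem primesBelow_five : Nat.primesBelow 5 = {2, 3} := by decide

/-- **The `{2,3}`-semilocal Weil form is non-negative on every test function supported in `[−(log 5)/2, (log 5)/2]`.**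
[cite: ConnesConsani2023, §2.1.2 (semilocal form; only prime powers `n ≤ λ²` enter); tree rung] -/
theorem weilSemilocalPositivityOn_two_three_log_five_half :
    WeilSemilocalPositivityOn ({2, 3} : Finset ℕ) (Real.log 5 / 2) := by
  have h := (handoffH_iff_weilSemilocalPositivityOn Nat.prime_three).1 handoffH_three
  rwa [nextPrime_three, primesBelow_five] at h

/-- **`D_5((log 5)/2) ≤ 0`**: the `{2,3}`-form has no aggregate deficit at the end of the window of `3`. [this track] -/
theorem aggregateDeficit_five_log_five_half_nonpos : aggregateDeficit 5 (Real.log 5 / 2) ≤ 0 := by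
  have h := (handoffH_iff_aggregateDeficit_nonpos consecutivePrimes_three_five).1 handoffH_three_five
  exact_mod_cast h

/-- **`D_3(b) ≤ cap(3) − ε(b)` with `0 ≤ ε(b)` on the whole window `b ∈ [(log 3)/2, (log 5)/2]`** — the aggregate necessary condition
`N(3)` WITH its margin, unconditionally. [this track] -/
theorem aggregateDeficit_three_le (hb : b ∈ Icc (Real.log 3 / 2) (Real.log 5 / 2)) :
    aggregateDeficit 3 b ≤ Real.log 3 / Real.sqrt 3 - weilGroundEnergy b ∧ 0 ≤ weilGroundEnergy b := by
  have h := aggregateDeficit_le_cap_sub_of_handoffH (b := b) consecutivePrimes_three_five handoffH_three_five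
  exact h (by exact_mod_cast hb)

/-- **`r(3) ≤ 1 − ε((log 5)/2)/cap(3)`** (DATA, single-lineage float, pre-directive: r(3) ≈ 0.972, XCHECK §7 — not certified here).
[this track] -/
theorem handoffLoad_three_five_le :
    handoffLoad 3 5 ≤ 1 - weilGroundEnergy (Real.log 5 / 2) / (Real.log 3 / Real.sqrt 3) := by
  have h := handoffLoad_le_one_sub_of_handoffH consecutivePrimes_three_five handoffH_three_five
  exact_mod_cast h

/-- **`r(3) ≤ 1`** unconditionally (conj-1's load at the second window; `RH ↔ ∀ q, r(q) ≤ 1`, `HandoffLoadCriterion`). [this track] -/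
theorem handoffLoad_three_five_le_one : handoffLoad 3 5 ≤ 1 :=
  handoffLoad_le_one_of_handoffH consecutivePrimes_three_five handoffH_three_five

/-- **`r(2) ≤ 1`** unconditionally (first window; DATA r(2) ≈ 0.878). [this track] -/
theorem handoffLoad_two_three_le_one : handoffLoad 2 3 ≤ 1 :=
  handoffLoad_le_one_of_handoffH consecutivePrimes_two_three Handoff.handoffH_two_three

/-- **`N(3)`**: `deficit_3(g) ≤ cap(3)‖g‖₂²` for every Weil test function on the window end (theory-1's `HandoffNormBound 3`). [this track] -/
theorem handoffNormBound_three : HandoffNormBound 3 := handoffH_three.normBound Nat.prime_three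

/-- In the load currency: `RH ↔ r(q) ≤ 1` for every prime `q ≥ 5` (`r(2), r(3) ≤ 1` are theorems; `←` goes through «`r ≤ 1` for
infinitely many primes ⟹ RH», NOT prime by prime — `N(q)` is necessary for `H(q)`, not sufficient). [this track] -/
theorem riemannHypothesis_iff_forall_ge_five_handoffLoad_le_one :
    Summit.RiemannHypothesis ↔ ∀ q : ℕ, q.Prime → 5 ≤ q → handoffLoad q (nextPrime q) ≤ 1 := by
  constructor
  · intro hRH q hq _
    exact riemannHypothesis_iff_forall_handoffLoad_le_one.1 hRH q hq
  · intro h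
    refine riemannHypothesis_of_frequently_handoffLoad_le_one fun N ↦ ?_
    obtain ⟨q, hNq, hq⟩ := Nat.exists_infinite_primes (max N 5)
    exact ⟨q, (le_max_left _ _).trans hNq, hq, h q hq ((le_max_right _ _).trans hNq)⟩

/-! ## §3  The next rung `H(5)`: its exact shapes -/

/-- `nextPrime 5 = 7`. [folklore] -/
theorem nextPrime_five : nextPrime 5 = 7 := by
  refine le_antisymm (nextPrime_le (by norm_num) (by norm_num)) ?_
  by_contra h
  have h6 : nextPrime 5 = 6 := by have := lt_nextPrime 5; omega
  exact absurd (nextPrime_prime 5) (by rw [h6]; decide)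

/-- `(5, 7)` is a consecutive-prime pair. [folklore] -/
theorem consecutivePrimes_five_seven : ConsecutivePrimes 5 7 := by
  have h := consecutivePrimes_nextPrime (show Nat.Prime 5 by norm_num)
  rwa [nextPrime_five] at h

/-- **`H(5)` IS EXACTLY the rung `WeilPositivityOn ((log 7)/2)`** (`(log 7)/2 = 0.97295…`; NOT in the tree at this write; CERTIFIED
two-lineage numerically via the two-sector brackets at `c = 49/50`, HANDOFF-STATEMENT §H.16 — a custodian-VERIFIED DATA object, not a theorem).
[cite: Yoshida1992HermitianForms, Prop. 6 (p. 320) (window form)] -/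
theorem handoffH_five_iff : HandoffH 5 ↔ WeilPositivityOn (Real.log 7 / 2) := by
  rw [handoffH_iff_weilPositivityOn (show Nat.Prime 5 by norm_num), nextPrime_five]
  norm_num

/-- Certificate shape of `H(5)` at the window end itself: `0 ≤ ε_ev((log 7)/2)` and `0 ≤ ε_od((log 7)/2)` give `H(5)`.
[cite: Bombieri2000Weil, §4 (Problem 2, Thm 5); Yoshida1992HermitianForms Prop. 6 (p. 320)] -/
theorem handoffH_five_of_sector_energies_log_seven_half (hev : 0 ≤ weilEvenGroundEnergy (Real.log 7 / 2))
    (hod : 0 ≤ weilOddGroundEnergy (Real.log 7 / 2)) : HandoffH 5 := by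
  have h := handoffH_of_sector_energies consecutivePrimes_five_seven (c := Real.log 7 / 2) (by norm_num) hev hod
  unfold HandoffDecomposition.HandoffH
  rwa [nextPrime_five]

/-- `7 ≤ e²` (kernel arithmetic: `7 < 2.7182818283²`). [folklore] -/
theorem seven_le_exp_two : ((7 : ℕ) : ℝ) ≤ Real.exp (2 * 1) :=
  natCast_le_exp_of_pow_lt (P := 7) (n := 1) (m := 2) (by norm_num) (by norm_num) (by norm_num)

/-- **The `c = 1` row of the rung table**: a two-sector certificate at bandwidth `1` gives `H(q)` for EVERY prime `q < 7` (`7 ≤ e²`), i.e.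
`H(2)`, `H(3)`, `H(5)`. [cite: Bombieri2000Weil, §4; this track] -/
theorem forall_handoffH_of_sector_energies_one (hev : 0 ≤ weilEvenGroundEnergy 1) (hod : 0 ≤ weilOddGroundEnergy 1) :
    ∀ q : ℕ, q.Prime → q < 7 → HandoffH q :=
  forall_handoffH_of_sector_energies (by norm_num) seven_le_exp_two hev hod

/-- The same from a Lean rung `WeilPositivityOn 1` (the cell's K-CELL-2 format-C target `weilPositivityOn_one`, NOT in the tree at this
write): `H(q)` for all primes `q < 7`. [this track] -/
theorem forall_handoffH_of_weilPositivityOn_one (hW : WeilPositivityOn 1) :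
    ∀ q : ℕ, q.Prime → q < 7 → HandoffH q := fun q hq hq7 ↦
  handoffH_of_weilPositivityOn_of_le_exp (consecutivePrimes_nextPrime hq)
    ((show (nextPrime q : ℝ) ≤ (7 : ℕ) by exact_mod_cast nextPrime_le (by norm_num) hq7).trans seven_le_exp_two) hW

/-- What the `a = 1` rung would pay in the increment currency: **`WeilPositivityOn 1 ⟹ (RH ↔ ∀ primes q ≥ 7, H′(q))`**. [this track] -/
theorem riemannHypothesis_iff_forall_ge_seven_handoffStep_of_weilPositivityOn_one (hW : WeilPositivityOn 1) :
    Summit.RiemannHypothesis ↔ ∀ q : ℕ, q.Prime → 7 ≤ q → HandoffStep q := by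
  rw [forall_ge_handoffStep_iff (by norm_num : Nat.Prime 7)]
  have h7 : WeilPositivityOn (Real.log (7 : ℕ) / 2) := hW.mono (log_half_le_of_le_exp (by norm_num) seven_le_exp_two)
  norm_num at h7
  exact ⟨fun h _ ↦ h, fun h ↦ h h7⟩

end Summit.RiemannHypothesis.RiemannHypothesis.Theorems.HandoffLadderTheoremRungs

end
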